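import Literature.Probability.RandomPlanarGeometry.SAWPatternFiniteMemory
import HarnessLib

/-!
# Pattern-tilted, symmetry-reduced Pönitz–Tittmann certificates

Topic `Literature/Probability/RandomPlanarGeometry` (continues `SAWPatternFiniteMemory.lean`).
The executable certificate: the tree's untrusted breadth-first search over NORMAL FORMS of the
memory-`K` automaton (`bfsC`, `K = 16`: `58 411`, `K = 18`: `336 168` states), a weighted integer
power iteration with the pattern-tilted letter weights `patW sel p q` (`p` on a letter completing a
turn / tight U-turn, `q` otherwise), and the verified `verifyPC`, which checks closure and the
weighted Collatz–Wielandt inequalities `D · Σ_d patW(a,d) · v(canon (ptStep a d)) ≤ N · v(a)` at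
every tabulated normal form. Since the pattern weights are invariant under the eight lattice
symmetries (`patW_map`) and the automaton is equivariant (`ptStep_map`), the inequalities hold on
whole orbits (`certificateS_of_verifyPC`), and with `wprodS_patW_eq`:

**`sum_sawWords_patW_mul_pow_le_of_checkPC`**:
`checkPC K sel p q N D iters = true → (Σ_{w ∈ sawWords n} p^{#pat(w)} q^{n-#pat(w)}) · Dⁿ ≤ Nⁿ · 2⁴¹`,
i.e. `Σ_{SAW_n} t^{#pat} ≤ 2⁴¹ (N/(Dq))ⁿ` for the tilt `t = p/q` — an explicit exponential bound
on the pattern-tilted partition function (the pressure), from which exponential Chebyshev bounds on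
the number of walks with few / many turns follow (`SAWTurnDensityWindow.lean`).

## Contents (namespace `Literature.Probability.RandomPlanarGeometry.SAW.FiniteMemory`)

* `transTablePC`, `searchPC` (untrusted), `verifyStatePC`, `verifyPC`, **`checkPC`**, `ratioPC`
  (telemetry);
* **`certificateS_of_verifyPC`** (soundness), **`sum_sawWords_patW_mul_pow_le_of_checkPC`**.

## References

* A. Pönitz, P. Tittmann, *Improved upper bounds for self-avoiding walks in ℤᵈ*, Electron. J.
  Combin. 7 (2000) R21, §3 (normalizing states; eigenvalue bound) [PonitzTittmann2000].
* N. Madras, G. Slade, *The Self-Avoiding Walk* (1993), §7.2 (pattern theorem) [MadrasSlade1993].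
-/

open Finset Literature.Probability.LatticeModels
open scoped BigOperators

namespace Literature.Probability.RandomPlanarGeometry.SAW

namespace FiniteMemory

/-! ### Untrusted search -/

/-- Pattern-weighted successor table over normal forms: for every tabulated state the list of
(letter weight, index of the normal form of the successor) (untrusted). [cite: PonitzTittmann2000, §3] -/
def transTablePC (K sel p q : ℕ) (states : Array (List Step)) (idx : Std.HashMap (List Step) ℕ) :
    Array (Array (ℕ × ℕ)) :=
  states.map fun a => Id.run do
    let mut acc : Array (ℕ × ℕ) := #[]
    for d in List.finRange 4 do
      match ptStep K a d with
      | none => pure ()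
      | some b => acc := acc.push (patW sel p q a d, idx.getD (canon b) 0)
    return acc

/-- Weighted integer power iteration (untrusted; same scheme as `powerIterW`).
[cite: PonitzTittmann2000, §3] -/
def powerIterP (T : Array (Array (ℕ × ℕ))) (iters : ℕ) : Array ℕ := Id.run do
  let n := T.size
  let mut v : Array ℕ := Array.replicate n (2 ^ 20)
  for _ in [0:iters] do
    let mut w : Array ℕ := Array.replicate n 0
    let mut mx : ℕ := 1
    for i in [0:n] do
      let s := (T[i]!).foldl (fun acc pr => acc + pr.1 * v[pr.2]!) 0
      w := w.set! i s
      if s > mx then mx := s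
    v := w.map fun s => s * 2 ^ 40 / mx + 1
  return v

/-- The reduced pattern-weighted search: normal forms, index, proposed weights (untrusted).
[cite: PonitzTittmann2000, §3] -/
def searchPC (K sel p q iters : ℕ) : Array (List Step) × Std.HashMap (List Step) ℕ × Array ℕ :=
  let (states, idx) := bfsC K
  (states, idx, powerIterP (transTablePC K sel p q states idx) iters)

/-! ### Verified check -/

/-- Check of the tabulated normal form number `i`: consistent index, normal form, positive weight,
normal forms of the successors tabulated, and the PATTERN-WEIGHTED Collatz–Wielandt inequality for
the symmetric weight. [cite: PonitzTittmann2000, §3] -/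
def verifyStatePC (K sel p q N D : ℕ) (states : Array (List Step)) (idx : Std.HashMap (List Step) ℕ)
    (v : Array ℕ) (i : ℕ) : Bool :=
  match states[i]?, v[i]? with
  | some a, some vi =>
    decide (idx[a]? = some i) && decide (canon a = a) && decide (1 ≤ vi) &&
      (List.finRange 4).all (fun d =>
        match ptStep K a d with
        | none => true
        | some b =>
          match idx[canon b]? with
          | none => false
          | some j => decide (states[j]? = some (canon b))) &&
      decide (D * (List.ofFn fun d : Step =>
          patW sel p q a d * ((ptStep K a d).map (weightC idx v)).getD 0).sum ≤ N * vi)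
  | _, _ => false

/-- The verified part of the reduced pattern-weighted check (also records `4 ≤ K`, needed to read
the pattern off the state). [cite: PonitzTittmann2000, §3] -/
def verifyPC (K sel p q N D : ℕ) (states : Array (List Step)) (idx : Std.HashMap (List Step) ℕ)
    (v : Array ℕ) : Bool :=
  decide (4 ≤ K) && decide (states[0]? = some []) && decide (weightC idx v [] ≤ 2 ^ 41) &&
    (List.range states.size).all (verifyStatePC K sel p q N D states idx v)

/-- **The pattern-tilted reduced certificate check** `checkPC K sel p q N D iters` (`sel = 0`:
turns, `sel = 1`: tight U-turns; tilt `t = p/q`): reduced search, then verify. Only ever evaluated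
by `native_decide`. [cite: PonitzTittmann2000, §3] -/
@[irreducible] def checkPC (K sel p q N D iters : ℕ) : Bool :=
  let r := searchPC K sel p q iters
  verifyPC K sel p q N D r.1 r.2.1 r.2.2

/-- Telemetry for choosing `N/D` (untrusted, never used in proofs): the number of normal forms and
`⌈10⁶ · max_a Σ_d patW(a,d) v(succ)/v(a)⌉`. [cite: PonitzTittmann2000, §3] -/
def ratioPC (K sel p q iters : ℕ) : ℕ × ℕ := Id.run do
  let r := searchPC K sel p q iters
  let states := r.1
  let idx := r.2.1
  let v := r.2.2
  let mut worst : ℕ := 0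
  for i in [0:states.size] do
    let a0 := states[i]!
    let s := (List.ofFn fun d : Step =>
      patW sel p q a0 d * ((ptStep K a0 d).map (weightC idx v)).getD 0).sum
    let qq := (s * 1000000 + v[i]! - 1) / v[i]!
    if qq > worst then worst := qq
  return (states.size, worst)

/-! ### Soundness -/

/-- Every symmetry has an inverse among the symmetries (pointwise form). [folklore] -/
private theorem syms_inv' : ∀ g ∈ syms, ∃ g' ∈ syms, (∀ d : Step, g' (g d) = d) ∧ ∀ d : Step, g (g' d) = d := by
  decide +kernel

/-- **Soundness of `verifyPC`**: a successful reduced pattern-weighted check yields a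
state-weighted Collatz–Wielandt certificate (`WordAutomaton.CertificateS`) for `ptStep K` with the
weights `patW sel p q`, on the states whose normal form is tabulated, with the symmetric weight
`a ↦ v[idx[canon a]]`, `weight([]) ≤ 2⁴¹` and `4 ≤ K`. [cite: PonitzTittmann2000, §3] -/
theorem certificateS_of_verifyPC {K sel p q N D : ℕ} {states : Array (List Step)}
    {idx : Std.HashMap (List Step) ℕ} {v : Array ℕ} (h : verifyPC K sel p q N D states idx v = true) :
    WordAutomaton.CertificateS (ptStep K) {a | ∃ i < states.size, states[i]? = some (canon a)}
      (weightC idx v) (patW sel p q) N D ∧ weightC idx v [] ≤ 2 ^ 41 ∧ 4 ≤ K := by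
  simp only [verifyPC, Bool.and_eq_true, decide_eq_true_eq, List.all_eq_true, List.mem_range] at h
  obtain ⟨⟨⟨hK, h0⟩, hroot⟩, hall⟩ := h
  -- unpack the check of a tabulated state
  have key : ∀ a : List Step, ∀ i < states.size, states[i]? = some a →
      idx[a]? = some i ∧ canon a = a ∧ 1 ≤ weightOf idx v a ∧
      (∀ d b, ptStep K a d = some b → ∃ j < states.size, states[j]? = some (canon b)) ∧
      D * ∑ d : Step, patW sel p q a d * ((ptStep K a d).map (weightC idx v)).getD 0 ≤
        N * weightOf idx v a := by
    intro a i hi ha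
    have hs := hall i hi
    unfold verifyStatePC at hs
    rw [ha] at hs
    cases hv : v[i]? with
    | none => simp [hv] at hs
    | some vi =>
      simp only [hv, Bool.and_eq_true, decide_eq_true_eq, List.all_eq_true] at hs
      obtain ⟨⟨⟨⟨hidx, hcan⟩, hvi⟩, hsucc⟩, hcw⟩ := hs
      have hw : weightOf idx v a = vi := by simp [weightOf, hidx, hv]
      refine ⟨hidx, hcan, hw ▸ hvi, fun d b hb => ?_, ?_⟩
      · have := hsucc d (List.mem_finRange d)
        rw [hb] at this
        cases hj : idx[canon b]? with
        | none => simp [hj] at this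
        | some j =>
          simp only [hj, decide_eq_true_eq] at this
          exact ⟨j, (Array.getElem?_eq_some_iff.1 this).1, this⟩
      · rw [hw, ← List.sum_ofFn]
        exact hcw
  refine ⟨⟨?_, ?_, ?_, ?_⟩, by simpa [weightC] using hroot, hK⟩
  · exact ⟨0, (Array.getElem?_eq_some_iff.1 h0).1, by rw [canon_nil]; exact h0⟩
  · rintro a ⟨i, hi, ha⟩ d b hb
    obtain ⟨g, hg, hga⟩ := exists_canon_eq a
    have hstep : ptStep K (canon a) (g d) = some (b.map g) := by
      rw [hga, ptStep_map hg, hb, Option.map_some]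
    obtain ⟨j, hj, hjb⟩ := (key _ i hi ha).2.2.2.1 (g d) (b.map g) hstep
    exact ⟨j, hj, by rw [canon_map hg] at hjb; exact hjb⟩
  · rintro a ⟨i, hi, ha⟩
    exact (key _ i hi ha).2.2.1
  · rintro a ⟨i, hi, ha⟩
    obtain ⟨g, hg, hga⟩ := exists_canon_eq a
    obtain ⟨g', hg', hinv1, hinv2⟩ := syms_inv' g hg
    have hcw := (key _ i hi ha).2.2.2.2
    -- successor weights AND letter weights of `a` and `canon a = g·a` agree up to the permutation `g`
    have hterm : ∀ d : Step, patW sel p q a d * ((ptStep K a d).map (weightC idx v)).getD 0 =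
        patW sel p q (canon a) (g d) * ((ptStep K (canon a) (g d)).map (weightC idx v)).getD 0 := by
      intro d
      rw [hga, ptStep_map hg, patW_map hg]
      cases ptStep K a d with
      | none => rfl
      | some b => simp only [Option.map_some, Option.getD_some, weightC, canon_map hg]
    have hsum : ∑ d : Step, patW sel p q a d * ((ptStep K a d).map (weightC idx v)).getD 0 =
        ∑ d : Step, patW sel p q (canon a) d * ((ptStep K (canon a) d).map (weightC idx v)).getD 0 := by
      simp only [hterm]
      exact Equiv.sum_comp ⟨g, g', hinv1, hinv2⟩
        (fun d => patW sel p q (canon a) d * ((ptStep K (canon a) d).map (weightC idx v)).getD 0)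
    rw [hsum]
    exact hcw

/-- **The pattern-tilted self-avoiding count from a successful reduced check**:
`(Σ_{w ∈ sawWords n} p^{#pat(w)} · q^{n - #pat(w)}) · Dⁿ ≤ Nⁿ · 2⁴¹` (`sel = 0`: `#pat` = number of
turns; `sel = 1`: number of tight U-turns). [cite: PonitzTittmann2000, §3] -/
theorem sum_sawWords_patW_mul_pow_le_of_checkPC {K sel p q N D iters : ℕ}
    (h : checkPC K sel p q N D iters = true) (n : ℕ) :
    (∑ w ∈ sawWords n, p ^ patCount sel w * q ^ (n - patCount sel w)) * D ^ n ≤ N ^ n * 2 ^ 41 := by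
  rw [checkPC] at h
  obtain ⟨hc, hroot, hK⟩ := certificateS_of_verifyPC h
  have h1 := WordAutomaton.sum_sawWords_wprodS_mul_pow_le hc (run_ne_none_of_isSAW K) n
  rw [weightC, canon_nil] at h1 hroot
  have h2 : ∑ w ∈ sawWords n, p ^ patCount sel w * q ^ (n - patCount sel w) =
      ∑ w ∈ sawWords n, WordAutomaton.wprodS (ptStep K) (patW sel p q) w := by
    refine sum_congr rfl fun w hw => ?_
    rw [mem_sawWords] at hw
    rw [wprodS_patW_eq hK sel p q hw.2, hw.1]
  rw [h2]
  exact le_trans h1 (Nat.mul_le_mul_left _ hroot)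

end FiniteMemory

end Literature.Probability.RandomPlanarGeometry.SAW
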